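import Summits.HodgeConjecture.CorCM.D2Bridge.ClosedPrintedMuKeyIdentLemD3DelRecConjOmegaT
import Literature.NumberTheory.Automorphic.Liu2021.AppendixC.EtaleBettiComparison
import Literature.NumberTheory.Automorphic.Liu2021.AppendixC.Thm418LabelSeparation
import Summits.HodgeConjecture.CorCM.HypLiu418.A3Liu418EtaleItems
import HarnessLib

/-!
# [Liu 2021, Thm 4.18, proof l. 2258–2266] «the labels `μ′ ≠ ν` contribute nothing» AT THE FACE of the headline — the registered stub
# `stub_galoisLabelSeparation` of `Lines/a3-liu418.lean` v3, from [Shimura 21.4] (`h21`) and [Liu Thm 4.15] pinned (`Thm415AtFace`) BY NAME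

Cell `hodgecm-mathlib` (D-0151), fan A, rung A-III, skeleton `Lines/a3-liu418.lean` v3 (sha16 1b96ade3f8b6b529), stub (S)
`stub_galoisLabelSeparation : StubGaloisLabelSeparation` (:570/:696; generic predicate `GaloisLabelSeparation` :252), KEY
`a3-galois-label-separation`, strategy «Thm 4.15 at μ′ + CM character of A_ν + ℓ-adic rigidity of μ ↦ μ^{alg}».

`StubGaloisLabelSeparation` says: for every `hDel`, every face prefix `(F, ι₁, V, a, Φ, ν)`, every prime `ℓ`, every étale Hecke datum `X` on
`H¹_ét(A_∞ ⊗_E Ē, ℚ_ℓ)` of `V`'s OWN §4.2 datum `ℭ_V = sec42DataOf … Φ` INDUCED by the Albanese Hecke translates `𝕋_V`, every `ι' : ℂ ≃+* ℚ_ℓ^{ac}`: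
for every CM datum `obj` of `ν` (over the cell's carrier `Carriers.ofPolDR ν (PolDR ι₁ hν (RMuForm ι₁ hν))`) and every labelled admissible
triple `t = (μ′, ε, χ)` of the relabelled family `muConj 𝕌_V` at `a` with `μ′ ≠ ν`, a NON-ZERO `f ∈ Hom_{ℚ_ℓ^{ac}[𝔾]}(ι'∘ω(μ′,ε,χ), ℚ_ℓ^{ac} ⊗ H¹_ét(A_∞))`
is moved by some `σ ∈ Γ_E` differently from the line `ℚ_ℓ^{ac}·α_ν` of `H¹_ét(A_ν)`.  The mathematics is the GENERIC theorem
`Literature.NumberTheory.Automorphic.Liu2021.AppendixC.galoisLabelSeparation_of_thm415Pinned_of_casselman`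
(`Liu2021/AppendixC/Thm418LabelSeparation.lean`: Serre–Tate §4 Thm 5 (i) for `ℚ_ℓ^{ac}·α ≠ 0`, [Def 4.5 (2)] in Frobenius form on the line,
Frobenius elements at almost all places, rigidity of Hecke characters `HeckeCharacter.ext_of_eventually_valueAtUniformizer_eq`,
`toHeckeCharacter_injective`); THIS FILE instantiates it at the face: `C := ℭ_V` (`n = 3` by `rfl`), `U := muConj 𝕌_V @ a`, `σ₁ := ι₁`, and
[Thm 4.15] supplied by the skeleton's head hypothesis `Thm415AtFace` — which is ALREADY universally quantified over the label, so it serves at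
`μ′` as well as at `ν` (no new named fact; debt Δ 0) — and [Liu Prop 4.6 (1)] «`𝒜(μ′) ≠ ∅`» supplied by the headline binder `h21`
([Shimura1998] Thm 21.4, `Def45.nonempty_cmDatum_polDR_rMuForm_of_casselman`).

STATEMENT SHAPE.  The skeleton's `AdmTripleAll U` (a `structure`, skeleton-local) and `GaloisLabelSeparation` / `Thm415AtFace` / `CV` / `UV` /
`TV` / `CarN` (skeleton-local `def`s ∕ `abbrev`s) are not tree declarations, so the theorem below is `StubGaloisLabelSeparation` with those
UNFOLDED and the triple `t` replaced by its fields `(t.μ, t.hμ, t.hw, t.ε, t.adm, t.χ)`; the hypothesis `h415` is the body of `Thm415AtFace`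
character for character (bound variable renamed `ν ↦ μ`).  SLOT FILL (for A-plan2's re-file, η/projection repackaging only):
```
theorem stub_galoisLabelSeparation_of (h21 : shimura1998_thm21_4_casselman) (h415 : Thm415AtFace) : StubGaloisLabelSeparation :=
  fun hDel F _ h6 ι₁ V a Φ hΦ ν hν hw ℓ _ X ι' hX obj t hne f hf hf0 =>
    stubGaloisLabelSeparation_of_casselman_of_thm415 h21 h415 hDel F h6 V a Φ hΦ ν hν hw ℓ X ι' hX obj t.μ t.hμ t.hw t.ε t.adm t.χ hne f hf hf0
```
and `stub_mainGalois_of … (stub_galoisLabelSeparation_of h21 h415) …` with `h21` threaded into `HypLiu418_of` (it is the headline's own binder).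
ORIENTATION: this stub is orientation-free; the sign S1 (A3-ORIENTATION §3) lives only in the instantiation `Thm415AtFace` it CONSUMES.
HC_CM is proved only modulo the 7 printed citations (`hDel`, `h21`, `hLiu418`, `h411`, `h413`, `hD3`, `hD1''`) until rung 0 closes; nothing of
[Liu2021] is asserted here: [Thm 4.15] (`h415`) and [Shimura 21.4] (`h21`) are HYPOTHESES.

References: [Liu2021] Y. Liu, *Fourier–Jacobi cycles and arithmetic relative trace formula*, Camb. J. Math. 9 (2021) = arXiv:2102.11518, Thm. 4.18
proof (FJcycle.tex l. 2258–2266), Thm. 4.15 (l. 2177–2182), Def. 4.5 (2) (l. 1952), Prop. 4.6 (1) (l. 1969); [SerreTate1968] §4 Thm 5 (i), §7;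
[CasselsFrohlichANT1967] Ch. VII §4 Prop. 4.1; [Shimura1998] Thm 21.4.
-/

set_option autoImplicit false

noncomputable section

namespace Summit.HodgeConjecture.CorCM.Lines.A3Liu418

open scoped TensorProduct Matrix
open NumberField NumberField.InfinitePlace
open HodgeCM.Model HodgeCM.Model.LiuIndex HodgeCM.Model.TowerCarrier
open HodgeCM.Literature.Theta.LiuAlbaneseModuleDatum.D2Bridge (HcmPieces)
open Summit.HodgeConjecture.CorCM.Model
open Literature.AlgebraicGeometry.Motives (CMType)
open Literature.AlgebraicGeometry.HodgeTheory Literature.NumberTheory.Automorphic.PicardCM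
open Literature.AlgebraicGeometry.ShimuraVarieties.UnitaryCanonicalModel
open Literature.NumberTheory.ComplexMultiplication
open Literature.NumberTheory.Automorphic
open Literature.NumberTheory.Automorphic.IdeleClassGroup (toHeckeCharacter isUnitary_toHeckeCharacter galConj)
open Literature.NumberTheory.Automorphic.Liu2021 Literature.NumberTheory.Automorphic.Liu2021.AppendixC
open Literature.NumberTheory.Automorphic.Liu2021.AppendixC.RestOne
open Literature.NumberTheory.Automorphic.Liu2021.Def411WeilCarriers (lineOf locF Rep)
open Summit.HodgeConjecture.CorCM.Transposition.OmegaTransport (realUnit)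
open HodgeCM.Model.ArchSideTerm (e₁)
open Literature.NumberTheory.GelbartRogawski1991 Literature.NumberTheory.GelbartRogawski1991.UnitaryDualPair
open Literature.NumberTheory.GelbartRogawski1991.UnitaryDualPair.LocalSplitting (localMu norm_localMu continuous_localMu localMu_toLocalRing_eq_one_iff
  eq_of_forall_localMu_toHeckeCharacter_eq)
open Literature.RepresentationTheory Literature.RepresentationTheory.Liu2021
open Summit.HodgeConjecture.CorCM.Transposition
open Summit.HodgeConjecture.CorCM.D2Bridge.AdapterMuConj (muConj prop413AsPrinted_muConj def411_muConj nontrivial_omegaAt_muConj_rest)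
open Summit.HodgeConjecture.CorCM.D2Bridge.MuKeyIdentEnd (hc_cm_of_printed_citations_muKey_ident)
open Summit.HodgeConjecture.CorCM.D2Bridge.MuKeyIdentLemD3End
open Summit.HodgeConjecture.CorCM.D2Bridge.MuKeyIdentLemD3DelRecConjOmegaEnd (diagonal_frameD_map_complexConj)

open Summit.HodgeConjecture.CorCM.D2Bridge.MuKeyIdentLemD3DelRecConjOmegaEndT (hc_cm_of_printed_citations_muKey_ident_lemD3_delRecConjOmegaT)
open scoped DirectSum
open Literature.AlgebraicGeometry.Liu2021 (IsAdmissibleElement)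

set_option synthInstance.maxHeartbeats 400000 in
set_option maxHeartbeats 8000000 in
/-- **`stub_galoisLabelSeparation` at the face, from `h21` and [Thm 4.15] pinned BY NAME** — [Liu2021, Thm 4.18 proof l. 2258–2266]: for `V`'s own
§4.2 datum `ℭ_V`, the relabelled oscillator family `muConj 𝕌_V` at `a`, every induced étale Hecke datum `X` and every `ι'`, a label `μ′ ≠ ν` with a
`μ′`-admissible `ε` and a NON-ZERO intertwiner `f ∈ Hom_{ℚ_ℓ^{ac}[𝔾]}(ι'∘ω(μ′,ε,χ), ℚ_ℓ^{ac} ⊗ H¹_ét(A_∞))` admit `σ ∈ Γ_E`, `c`, a non-zero `c`-eigenvector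
`x` of `σ` on the line `ℚ_ℓ^{ac}·α_ν` and a `w` with `σ·f(w) ≠ c·f(w)` — the skeleton's `StubGaloisLabelSeparation` with `AdmTripleAll` ∕
`GaloisLabelSeparation` ∕ `CV` ∕ `UV` ∕ `TV` ∕ `CarN` unfolded (module docstring, STATEMENT SHAPE); `h415` is the body of `Thm415AtFace`.  KERNEL:
`galoisLabelSeparation_of_thm415Pinned_of_casselman` at `C := ℭ_V` (`3 ≤ n` is `le_refl 3`), `U := muConj 𝕌_V @ a`, `σ₁ := ι₁`.  HC_CM is proved
only modulo the 7 printed citations; [Thm 4.15] and [Shimura 21.4] are hypotheses.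
[cite: Liu2021, Thm 4.18 proof (FJcycle.tex l. 2258–2266); Thm 4.15 (l. 2177–2182); Def. 4.5 (2) (l. 1952); Prop. 4.6 (1) (l. 1969)]
[cite: Shimura1998, §21.4 Thm. 21.4] [cite: SerreTate1968, §4 Thm. 5 (i)] [cite: CasselsFrohlichANT1967, Ch. VII §4 Prop. 4.1] -/
theorem stubGaloisLabelSeparation_of_casselman_of_thm415
    (h21 : shimura1998_thm21_4_casselman)
    (h415 : ∀ (hDel : Literature.AlgebraicGeometry.ShimuraVarieties.UnitaryCanonicalModel.canonicalModel_exists_printed)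
      (F : HodgeCM.CMField) [IsGalois ℚ F] (h6 : 6 ≤ Module.finrank ℚ F) {ι₁ : F →+* ℂ} (V : HodgeCM.HermSpace3 F ι₁) (a : RealScalar F)
      (Φ : CMType F) (hΦ : ι₁ ∈ Φ.1) (μ : Literature.NumberTheory.Automorphic.IdeleClassGroup (F : Type) →ₜ* Circle)
      (hμ : IdeleClassGroup.IsConjugateSymplectic (F : Type) μ) (hwμ : IdeleClassGroup.HasWeight (F : Type) μ 1)
      (ℓ : ℕ) [Fact ℓ.Prime] (X : (sec42DataOf (Summit.HodgeConjecture.CorCM.DelRec.exists_recordSystem_of_printed hDel) isoOf ⟨HodgeCM.CMField.K F⟩ ι₁ ⟨HodgeCM.HermSpace3.Hm V, HodgeCM.HermSpace3.isHermitian V, HodgeCM.HermSpace3.signature_ι₁ V, HodgeCM.HermSpace3.posDef_of_ne V⟩ Φ).EtaleHeckeDatum ℓ) (ι' : ℂ ≃+* AlgebraicClosure ℚ_[ℓ])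
      (obj : RestOne.ObjOne (AlgHom.id ℚ _) ι₁ hμ hwμ (Def45.Carriers.ofPolDR μ (Def45.PolDR ι₁ hμ (Def45.RMuForm ι₁ hμ)))),
      X.IsInducedBy (heckeTranslatesFamilyOf heckeTranslate_definedOver_holds (Summit.HodgeConjecture.CorCM.DelRec.exists_recordSystem_of_printed hDel) isoOf ⟨HodgeCM.CMField.K F⟩ ι₁ ⟨HodgeCM.HermSpace3.Hm V, HodgeCM.HermSpace3.isHermitian V, HodgeCM.HermSpace3.signature_ι₁ V, HodgeCM.HermSpace3.posDef_of_ne V⟩ Φ h6) →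
        Thm415Pinned (sec42DataOf (Summit.HodgeConjecture.CorCM.DelRec.exists_recordSystem_of_printed hDel) isoOf ⟨HodgeCM.CMField.K F⟩ ι₁ ⟨HodgeCM.HermSpace3.Hm V, HodgeCM.HermSpace3.isHermitian V, HodgeCM.HermSpace3.signature_ι₁ V, HodgeCM.HermSpace3.posDef_of_ne V⟩ Φ) (Summit.HodgeConjecture.CorCM.D2Bridge.AdapterMuConj.muConj (uniformOmegaRep (Summit.HodgeConjecture.CorCM.DelRec.exists_recordSystem_of_printed hDel) ⟨HodgeCM.CMField.K F⟩ ι₁ ⟨HodgeCM.HermSpace3.Hm V, HodgeCM.HermSpace3.isHermitian V, HodgeCM.HermSpace3.signature_ι₁ V, HodgeCM.HermSpace3.posDef_of_ne V⟩ Φ e₁ (frameD V) (frameD_real V) (frameD_ne V) (ιVE V) (2 * imagUnit (HodgeCM.CMField.K F))⁻¹ (fun _ _ => (Rep.update ↥(maximalRealSubfield (HodgeCM.CMField.K F)) (imagUnitSq (HodgeCM.CMField.K F)) (Rep.ofLineOf ↥(maximalRealSubfield (HodgeCM.CMField.K F)) (imagUnitSq (HodgeCM.CMField.K F))) (locF ↥(maximalRealSubfield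 (HodgeCM.CMField.K F)) (imagUnitSq (HodgeCM.CMField.K F)) (realUnit ⟨HodgeCM.CMField.K F⟩ a.1 a.2.1 a.2.2)) (realUnit ⟨HodgeCM.CMField.K F⟩ a.1 a.2.1 a.2.2) rfl)))) ℓ X ι' μ hμ (RestOne.AμOne (AlgHom.id ℚ _) ι₁ hμ hwμ (Def45.Carriers.ofPolDR μ (Def45.PolDR ι₁ hμ (Def45.RMuForm ι₁ hμ))) obj)
          (RestOne.iOne (AlgHom.id ℚ _) ι₁ hμ hwμ (Def45.Carriers.ofPolDR μ (Def45.PolDR ι₁ hμ (Def45.RMuForm ι₁ hμ))) obj))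
    (hDel : Literature.AlgebraicGeometry.ShimuraVarieties.UnitaryCanonicalModel.canonicalModel_exists_printed)
    (F : HodgeCM.CMField) [IsGalois ℚ F] (h6 : 6 ≤ Module.finrank ℚ F) {ι₁ : F →+* ℂ} (V : HodgeCM.HermSpace3 F ι₁) (a : RealScalar F)
    (Φ : CMType F) (hΦ : ι₁ ∈ Φ.1) (ν : Literature.NumberTheory.Automorphic.IdeleClassGroup (F : Type) →ₜ* Circle)
    (hν : IdeleClassGroup.IsConjugateSymplectic (F : Type) ν) (hw : IdeleClassGroup.HasWeight (F : Type) ν 1)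
    (ℓ : ℕ) [Fact ℓ.Prime] (X : (sec42DataOf (Summit.HodgeConjecture.CorCM.DelRec.exists_recordSystem_of_printed hDel) isoOf ⟨HodgeCM.CMField.K F⟩ ι₁ ⟨HodgeCM.HermSpace3.Hm V, HodgeCM.HermSpace3.isHermitian V, HodgeCM.HermSpace3.signature_ι₁ V, HodgeCM.HermSpace3.posDef_of_ne V⟩ Φ).EtaleHeckeDatum ℓ) (ι' : ℂ ≃+* AlgebraicClosure ℚ_[ℓ]) :
    X.IsInducedBy (heckeTranslatesFamilyOf heckeTranslate_definedOver_holds (Summit.HodgeConjecture.CorCM.DelRec.exists_recordSystem_of_printed hDel) isoOf ⟨HodgeCM.CMField.K F⟩ ι₁ ⟨HodgeCM.HermSpace3.Hm V, HodgeCM.HermSpace3.isHermitian V, HodgeCM.HermSpace3.signature_ι₁ V, HodgeCM.HermSpace3.posDef_of_ne V⟩ Φ h6) →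
      ∀ (obj : RestOne.ObjOne (AlgHom.id ℚ _) ι₁ hν hw (Def45.Carriers.ofPolDR ν (Def45.PolDR ι₁ hν (Def45.RMuForm ι₁ hν))))
        (μ' : Literature.NumberTheory.Automorphic.IdeleClassGroup (F : Type) →ₜ* Circle)
        (hμ' : IdeleClassGroup.IsConjugateSymplectic (F : Type) μ') (hw' : IdeleClassGroup.HasWeight (F : Type) μ' 1)
        (ε : (Summit.HodgeConjecture.CorCM.D2Bridge.AdapterMuConj.muConj (uniformOmegaRep (Summit.HodgeConjecture.CorCM.DelRec.exists_recordSystem_of_printed hDel) ⟨HodgeCM.CMField.K F⟩ ι₁ ⟨HodgeCM.HermSpace3.Hm V, HodgeCM.HermSpace3.isHermitian V, HodgeCM.HermSpace3.signature_ι₁ V, HodgeCM.HermSpace3.posDef_of_ne V⟩ Φ e₁ (frameD V) (frameD_real V) (frameD_ne V) (ιVE V) (2 * imagUnit (HodgeCM.CMField.K F))⁻¹ (fun _ _ => (Rep.update ↥(maximalRealSubfield (HodgeCM.CMField.K F)) (imagUnitSq (HodgeCM.CMField.K F)) (Rep.ofLineOf ↥(maximalRealSubfield (HodgeCM.CMField.K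 F)) (imagUnitSq (HodgeCM.CMField.K F))) (locF ↥(maximalRealSubfield (HodgeCM.CMField.K F)) (imagUnitSq (HodgeCM.CMField.K F)) (realUnit ⟨HodgeCM.CMField.K F⟩ a.1 a.2.1 a.2.2)) (realUnit ⟨HodgeCM.CMField.K F⟩ a.1 a.2.1 a.2.2) rfl)))).Eps) (_ : ∃ e : (F : Type), IsAdmissibleElement (F : Type) hμ'.cmType.1 e ∧ (Summit.HodgeConjecture.CorCM.D2Bridge.AdapterMuConj.muConj (uniformOmegaRep (Summit.HodgeConjecture.CorCM.DelRec.exists_recordSystem_of_printed hDel) ⟨HodgeCM.CMField.K F⟩ ι₁ ⟨HodgeCM.HermSpace3.Hm V, HodgeCM.HermSpace3.isHermitian V, HodgeCM.HermSpace3.signature_ι₁ V, HodgeCM.HermSpace3.posDef_of_ne V⟩ Φ e₁ (frameD V) (frameD_real V) (frameD_ne V) (ιVE V) (2 * imagUnit (HodgeCM.CMField.K F))⁻¹ (fun _ _ => (Rep.update ↥(maximalRealSubfield (HodgeCM.CMField.K F)) (imagUnitSq (HodgeCM.CMField.K F)) (Rep.ofLineOf ↥(maximalRealSubfield (HodgeCM.CMField.K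 F)) (imagUnitSq (HodgeCM.CMField.K F))) (locF ↥(maximalRealSubfield (HodgeCM.CMField.K F)) (imagUnitSq (HodgeCM.CMField.K F)) (realUnit ⟨HodgeCM.CMField.K F⟩ a.1 a.2.1 a.2.2)) (realUnit ⟨HodgeCM.CMField.K F⟩ a.1 a.2.1 a.2.2) rfl)))).epsOf e = ε) (χ : (Summit.HodgeConjecture.CorCM.D2Bridge.AdapterMuConj.muConj (uniformOmegaRep (Summit.HodgeConjecture.CorCM.DelRec.exists_recordSystem_of_printed hDel) ⟨HodgeCM.CMField.K F⟩ ι₁ ⟨HodgeCM.HermSpace3.Hm V, HodgeCM.HermSpace3.isHermitian V, HodgeCM.HermSpace3.signature_ι₁ V, HodgeCM.HermSpace3.posDef_of_ne V⟩ Φ e₁ (frameD V) (frameD_real V) (frameD_ne V) (ιVE V) (2 * imagUnit (HodgeCM.CMField.K F))⁻¹ (fun _ _ => (Rep.update ↥(maximalRealSubfield (HodgeCM.CMField.K F)) (imagUnitSq (HodgeCM.CMField.K F)) (Rep.ofLineOf ↥(maximalRealSubfield (HodgeCM.CMField.K F)) (imagUnitSq (HodgeCM.CMField.K F))) (locF ↥(maximalRealSubfield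 (HodgeCM.CMField.K F)) (imagUnitSq (HodgeCM.CMField.K F)) (realUnit ⟨HodgeCM.CMField.K F⟩ a.1 a.2.1 a.2.2)) (realUnit ⟨HodgeCM.CMField.K F⟩ a.1 a.2.1 a.2.2) rfl)))).Chi),
        μ' ≠ ν →
        ∀ f ∈ X.omegaHom ι' ((Summit.HodgeConjecture.CorCM.D2Bridge.AdapterMuConj.muConj (uniformOmegaRep (Summit.HodgeConjecture.CorCM.DelRec.exists_recordSystem_of_printed hDel) ⟨HodgeCM.CMField.K F⟩ ι₁ ⟨HodgeCM.HermSpace3.Hm V, HodgeCM.HermSpace3.isHermitian V, HodgeCM.HermSpace3.signature_ι₁ V, HodgeCM.HermSpace3.posDef_of_ne V⟩ Φ e₁ (frameD V) (frameD_real V) (frameD_ne V) (ιVE V) (2 * imagUnit (HodgeCM.CMField.K F))⁻¹ (fun _ _ => (Rep.update ↥(maximalRealSubfield (HodgeCM.CMField.K F)) (imagUnitSq (HodgeCM.CMField.K F)) (Rep.ofLineOf ↥(maximalRealSubfield (HodgeCM.CMField.K F)) (imagUnitSq (HodgeCM.CMField.K F))) (locF ↥(maximalRealSubfield (HodgeCM.CMField.K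 F)) (imagUnitSq (HodgeCM.CMField.K F)) (realUnit ⟨HodgeCM.CMField.K F⟩ a.1 a.2.1 a.2.2)) (realUnit ⟨HodgeCM.CMField.K F⟩ a.1 a.2.1 a.2.2) rfl)))).rho μ' hμ' ε χ), f ≠ 0 →
      ∃ (σ : Field.absoluteGaloisGroup (F : Type)) (c : AlgebraicClosure ℚ_[ℓ]),
        (∃ x ∈ cmEigenline ℓ (RestOne.AμOne (AlgHom.id ℚ _) ι₁ hν hw (Def45.Carriers.ofPolDR ν (Def45.PolDR ι₁ hν (Def45.RMuForm ι₁ hν))) obj) (IdeleClassGroup.muAlgValueField (F : Type) ν) (RestOne.iOne (AlgHom.id ℚ _) ι₁ hν hw (Def45.Carriers.ofPolDR ν (Def45.PolDR ι₁ hν (Def45.RMuForm ι₁ hν))) obj) ι',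
            x ≠ 0 ∧ galoisH1Bar ℓ (RestOne.AμOne (AlgHom.id ℚ _) ι₁ hν hw (Def45.Carriers.ofPolDR ν (Def45.PolDR ι₁ hν (Def45.RMuForm ι₁ hν))) obj) σ x = c • x) ∧
        ∃ w : (Summit.HodgeConjecture.CorCM.D2Bridge.AdapterMuConj.muConj (uniformOmegaRep (Summit.HodgeConjecture.CorCM.DelRec.exists_recordSystem_of_printed hDel) ⟨HodgeCM.CMField.K F⟩ ι₁ ⟨HodgeCM.HermSpace3.Hm V, HodgeCM.HermSpace3.isHermitian V, HodgeCM.HermSpace3.signature_ι₁ V, HodgeCM.HermSpace3.posDef_of_ne V⟩ Φ e₁ (frameD V) (frameD_real V) (frameD_ne V) (ιVE V) (2 * imagUnit (HodgeCM.CMField.K F))⁻¹ (fun _ _ => (Rep.update ↥(maximalRealSubfield (HodgeCM.CMField.K F)) (imagUnitSq (HodgeCM.CMField.K F)) (Rep.ofLineOf ↥(maximalRealSubfield (HodgeCM.CMField.K F)) (imagUnitSq (HodgeCM.CMField.K F))) (locF ↥(maximalRealSubfield (HodgeCM.CMField.K F)) (imagUnitSq (HodgeCM.CMField.K F)) (realUnit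 ⟨HodgeCM.CMField.K F⟩ a.1 a.2.1 a.2.2)) (realUnit ⟨HodgeCM.CMField.K F⟩ a.1 a.2.1 a.2.2) rfl)))).omega μ' hμ' ε χ, ((sec42DataOf (Summit.HodgeConjecture.CorCM.DelRec.exists_recordSystem_of_printed hDel) isoOf ⟨HodgeCM.CMField.K F⟩ ι₁ ⟨HodgeCM.HermSpace3.Hm V, HodgeCM.HermSpace3.isHermitian V, HodgeCM.HermSpace3.signature_ι₁ V, HodgeCM.HermSpace3.posDef_of_ne V⟩ Φ).towerRep ℓ σ).baseChange (AlgebraicClosure ℚ_[ℓ]) (f w) ≠ c • f w := by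
  intro hX obj μ' hμ' hw' ε hε χ hne f hf hf0
  exact galoisLabelSeparation_of_thm415Pinned_of_casselman _ (le_refl 3) _ ι₁ ℓ X ι' h21
    (fun μ hμ hwμ obj' => h415 hDel F h6 V a Φ hΦ μ hμ hwμ ℓ X ι' obj' hX) hν hw obj hμ' hw' ε hε χ hne hf hf0

set_option synthInstance.maxHeartbeats 400000 in
set_option maxHeartbeats 8000000 in
/-- **`stub_galoisLabelSeparation` BY NAME** (appended 2026-08-28 after A-p06's `A3Liu418EtaleItems.lean`, p598646, put the skeleton's §EtaleItems
`AdmTripleAll` ∕ `GaloisLabelSeparation` in the tree under this namespace): the statement below is the skeleton's `StubGaloisLabelSeparation` (:570–:577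
of `Lines/a3-liu418.lean` v3 1b96ade3f8b6b529) CHARACTER FOR CHARACTER with only the face abbreviations `CV` ∕ `UV` ∕ `TV` ∕ `CarN` (:439–:461) unfolded,
so the skeleton's slot fill is `theorem stub_galoisLabelSeparation_of (h21) (h415 : Thm415AtFace) : StubGaloisLabelSeparation :=
stubGaloisLabelSeparation_byName_of_casselman_of_thm415 h21 h415` (abbrevs unfold definitionally).  Proof: the field-form theorem above at
`t.μ, t.hμ, t.hw, t.ε, t.adm, t.χ`.  HC_CM is proved only modulo the 7 printed citations; [Thm 4.15] (`h415` = the body of `Thm415AtFace`) and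
[Shimura 21.4] (`h21`) are hypotheses. [cite: Liu2021, Thm 4.18 proof (FJcycle.tex l. 2258–2266); Thm 4.15 (l. 2177–2182)] -/
theorem stubGaloisLabelSeparation_byName_of_casselman_of_thm415
    (h21 : shimura1998_thm21_4_casselman)
    (h415 : ∀ (hDel : Literature.AlgebraicGeometry.ShimuraVarieties.UnitaryCanonicalModel.canonicalModel_exists_printed)
      (F : HodgeCM.CMField) [IsGalois ℚ F] (h6 : 6 ≤ Module.finrank ℚ F) {ι₁ : F →+* ℂ} (V : HodgeCM.HermSpace3 F ι₁) (a : RealScalar F)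
      (Φ : CMType F) (hΦ : ι₁ ∈ Φ.1) (μ : Literature.NumberTheory.Automorphic.IdeleClassGroup (F : Type) →ₜ* Circle)
      (hμ : IdeleClassGroup.IsConjugateSymplectic (F : Type) μ) (hwμ : IdeleClassGroup.HasWeight (F : Type) μ 1)
      (ℓ : ℕ) [Fact ℓ.Prime] (X : (sec42DataOf (Summit.HodgeConjecture.CorCM.DelRec.exists_recordSystem_of_printed hDel) isoOf ⟨HodgeCM.CMField.K F⟩ ι₁ ⟨HodgeCM.HermSpace3.Hm V, HodgeCM.HermSpace3.isHermitian V, HodgeCM.HermSpace3.signature_ι₁ V, HodgeCM.HermSpace3.posDef_of_ne V⟩ Φ).EtaleHeckeDatum ℓ) (ι' : ℂ ≃+* AlgebraicClosure ℚ_[ℓ])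
      (obj : RestOne.ObjOne (AlgHom.id ℚ _) ι₁ hμ hwμ (Def45.Carriers.ofPolDR μ (Def45.PolDR ι₁ hμ (Def45.RMuForm ι₁ hμ)))),
      X.IsInducedBy (heckeTranslatesFamilyOf heckeTranslate_definedOver_holds (Summit.HodgeConjecture.CorCM.DelRec.exists_recordSystem_of_printed hDel) isoOf ⟨HodgeCM.CMField.K F⟩ ι₁ ⟨HodgeCM.HermSpace3.Hm V, HodgeCM.HermSpace3.isHermitian V, HodgeCM.HermSpace3.signature_ι₁ V, HodgeCM.HermSpace3.posDef_of_ne V⟩ Φ h6) →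
        Thm415Pinned (sec42DataOf (Summit.HodgeConjecture.CorCM.DelRec.exists_recordSystem_of_printed hDel) isoOf ⟨HodgeCM.CMField.K F⟩ ι₁ ⟨HodgeCM.HermSpace3.Hm V, HodgeCM.HermSpace3.isHermitian V, HodgeCM.HermSpace3.signature_ι₁ V, HodgeCM.HermSpace3.posDef_of_ne V⟩ Φ) (Summit.HodgeConjecture.CorCM.D2Bridge.AdapterMuConj.muConj (uniformOmegaRep (Summit.HodgeConjecture.CorCM.DelRec.exists_recordSystem_of_printed hDel) ⟨HodgeCM.CMField.K F⟩ ι₁ ⟨HodgeCM.HermSpace3.Hm V, HodgeCM.HermSpace3.isHermitian V, HodgeCM.HermSpace3.signature_ι₁ V, HodgeCM.HermSpace3.posDef_of_ne V⟩ Φ e₁ (frameD V) (frameD_real V) (frameD_ne V) (ιVE V) (2 * imagUnit (HodgeCM.CMField.K F))⁻¹ (fun _ _ => (Rep.update ↥(maximalRealSubfield (HodgeCM.CMField.K F)) (imagUnitSq (HodgeCM.CMField.K F)) (Rep.ofLineOf ↥(maximalRealSubfield (HodgeCM.CMField.K F)) (imagUnitSq (HodgeCM.CMField.K F))) (locF ↥(maximalRealSubfield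 (HodgeCM.CMField.K F)) (imagUnitSq (HodgeCM.CMField.K F)) (realUnit ⟨HodgeCM.CMField.K F⟩ a.1 a.2.1 a.2.2)) (realUnit ⟨HodgeCM.CMField.K F⟩ a.1 a.2.1 a.2.2) rfl)))) ℓ X ι' μ hμ (RestOne.AμOne (AlgHom.id ℚ _) ι₁ hμ hwμ (Def45.Carriers.ofPolDR μ (Def45.PolDR ι₁ hμ (Def45.RMuForm ι₁ hμ))) obj)
          (RestOne.iOne (AlgHom.id ℚ _) ι₁ hμ hwμ (Def45.Carriers.ofPolDR μ (Def45.PolDR ι₁ hμ (Def45.RMuForm ι₁ hμ))) obj)) :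
    ∀ (hDel : Literature.AlgebraicGeometry.ShimuraVarieties.UnitaryCanonicalModel.canonicalModel_exists_printed)
      (F : HodgeCM.CMField) [IsGalois ℚ F] (h6 : 6 ≤ Module.finrank ℚ F) {ι₁ : F →+* ℂ} (V : HodgeCM.HermSpace3 F ι₁) (a : RealScalar F)
      (Φ : CMType F) (hΦ : ι₁ ∈ Φ.1) (ν : Literature.NumberTheory.Automorphic.IdeleClassGroup (F : Type) →ₜ* Circle)
      (hν : IdeleClassGroup.IsConjugateSymplectic (F : Type) ν) (hw : IdeleClassGroup.HasWeight (F : Type) ν 1)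
      (ℓ : ℕ) [Fact ℓ.Prime] (X : (sec42DataOf (Summit.HodgeConjecture.CorCM.DelRec.exists_recordSystem_of_printed hDel) isoOf ⟨HodgeCM.CMField.K F⟩ ι₁ ⟨HodgeCM.HermSpace3.Hm V, HodgeCM.HermSpace3.isHermitian V, HodgeCM.HermSpace3.signature_ι₁ V, HodgeCM.HermSpace3.posDef_of_ne V⟩ Φ).EtaleHeckeDatum ℓ) (ι' : ℂ ≃+* AlgebraicClosure ℚ_[ℓ]),
      X.IsInducedBy (heckeTranslatesFamilyOf heckeTranslate_definedOver_holds (Summit.HodgeConjecture.CorCM.DelRec.exists_recordSystem_of_printed hDel) isoOf ⟨HodgeCM.CMField.K F⟩ ι₁ ⟨HodgeCM.HermSpace3.Hm V, HodgeCM.HermSpace3.isHermitian V, HodgeCM.HermSpace3.signature_ι₁ V, HodgeCM.HermSpace3.posDef_of_ne V⟩ Φ h6) →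
        GaloisLabelSeparation (Summit.HodgeConjecture.CorCM.D2Bridge.AdapterMuConj.muConj (uniformOmegaRep (Summit.HodgeConjecture.CorCM.DelRec.exists_recordSystem_of_printed hDel) ⟨HodgeCM.CMField.K F⟩ ι₁ ⟨HodgeCM.HermSpace3.Hm V, HodgeCM.HermSpace3.isHermitian V, HodgeCM.HermSpace3.signature_ι₁ V, HodgeCM.HermSpace3.posDef_of_ne V⟩ Φ e₁ (frameD V) (frameD_real V) (frameD_ne V) (ιVE V) (2 * imagUnit (HodgeCM.CMField.K F))⁻¹ (fun _ _ => (Rep.update ↥(maximalRealSubfield (HodgeCM.CMField.K F)) (imagUnitSq (HodgeCM.CMField.K F)) (Rep.ofLineOf ↥(maximalRealSubfield (HodgeCM.CMField.K F)) (imagUnitSq (HodgeCM.CMField.K F))) (locF ↥(maximalRealSubfield (HodgeCM.CMField.K F)) (imagUnitSq (HodgeCM.CMField.K F)) (realUnit ⟨HodgeCM.CMField.K F⟩ a.1 a.2.1 a.2.2)) (realUnit ⟨HodgeCM.CMField.K F⟩ a.1 a.2.1 a.2.2) rfl)))) (AlgHom.id ℚ _) ι₁ hν hw (Def45.Carriers.ofPolDR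 ν (Def45.PolDR ι₁ hν (Def45.RMuForm ι₁ hν))) ℓ X ι' := by
  intro hDel F _ h6 _ V a Φ hΦ ν hν hw ℓ _ X ι' hX obj t hne f hf hf0
  exact stubGaloisLabelSeparation_of_casselman_of_thm415 h21 h415 hDel F h6 V a Φ hΦ ν hν hw ℓ X ι' hX obj t.μ t.hμ t.hw t.ε t.adm t.χ
    hne f hf hf0

end Summit.HodgeConjecture.CorCM.Lines.A3Liu418

end
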